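import Mathlib
import Summits.AtomisticToContinuum.HydrodynamicLimit.Theorems.RelayRaceLocalityNearConstantShortTimeHLGronwallToolsB
import HarnessLib

/-!
# Crux `NearConstantShortTimeHL` (stmt-AtomisticToContinuum-12502), line `small-tilt-domination`:
# stub `integral_comp_flow_le_klDiv_add_log_of_nonneg`

The entropy (Gibbs / Donsker–Varadhan) inequality along the hard-sphere flow for an UNBOUNDED
nonnegative static functional `G` (the lead applies it to the mesoscale fluctuation, bounded only by
`2 +` kinetic energy): if the reference law `Q` has exponential moment
`∫ e^{c G} dQ ≤ e^κ` (stated with the lower Lebesgue integral, so that no integrability is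
presupposed) and `G ∘ Φ_r` is `P`-integrable, then
`E_P[G ∘ Φ_r] ≤ c⁻¹ (KL((Φ_r)_* P ‖ Q) + κ)`.

Route (folklore): truncate `G_N = min G N`, `0 ≤ G_N ≤ N`, apply the bounded version
`integral_comp_flow_le_klDiv_add_log` (…GronwallToolsB), bound the exponential moment of the
truncation by the hypothesis (`∫ = (∫⁻).toReal`, monotonicity, `log ≤ κ`), and let `N → ∞` by
dominated convergence with the integrable dominator `G ∘ Φ_r`.

No definitions, no named facts.
-/

noncomputable section

namespace Summit.AtomisticToContinuum.HydrodynamicLimit.Theorems.NearConstantShortTimeHL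

open scoped BigOperators ENNReal
open MeasureTheory Set Filter
open Literature.MathematicalPhysics.KineticTheory Literature.Analysis.FluidPDE Literature.Analysis.FunctionSpaces

/-! ### Truncation -/

/-- The truncations `min a N`, `N ∈ ℕ`, converge to `a` (they are eventually equal to `a`).
[folklore] -/
theorem wd_tendsto_min_natCast (a : ℝ) : Tendsto (fun N : ℕ => min a (N : ℝ)) atTop (nhds a) :=
  tendsto_const_nhds.congr'
    ((tendsto_natCast_atTop_atTop.eventually_ge_atTop a).mono fun _ hN => (min_eq_left hN).symm)

/-- **Exponential moment of a truncation.** If `∫⁻ e^{c G} dQ ≤ e^κ` (lower Lebesgue integral),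
`c > 0`, then for the truncation `min G N ≤ G` the Bochner integral satisfies
`log ∫ e^{c min G N} dQ ≤ κ` (the integrand is bounded by `e^{cN}`, hence integrable under the
probability measure `Q`, and the integral is positive). [folklore] -/
theorem wd_log_integral_exp_mul_min_le {α : Type*} [MeasurableSpace α] (Q : Measure α)
    [IsProbabilityMeasure Q] {G : α → ℝ} (hG : Measurable G) {c κ : ℝ} (hc : 0 < c)
    (hexp : ∫⁻ w, ENNReal.ofReal (Real.exp (c * G w)) ∂Q ≤ ENNReal.ofReal (Real.exp κ)) (N : ℕ) :
    Real.log (∫ w, Real.exp (c * min (G w) (N : ℝ)) ∂Q) ≤ κ := by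
  have hGN : Measurable fun w => min (G w) (N : ℝ) := hG.min measurable_const
  -- the truncated exponential is bounded by `exp (c N)`, hence integrable
  have hintQ : Integrable (fun w => Real.exp (c * min (G w) (N : ℝ))) Q := by
    refine (integrable_const (Real.exp (c * N))).mono' ?_ (Eventually.of_forall fun w => ?_)
    · exact (Real.measurable_exp.comp (measurable_const.mul hGN)).aestronglyMeasurable
    · rw [Real.norm_eq_abs, abs_of_pos (Real.exp_pos _)]
      exact Real.exp_le_exp.2 (mul_le_mul_of_nonneg_left (min_le_right _ _) hc.le)
  -- and bounded by `exp (c G)`, whose lower integral is at most `exp κ`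
  have hX : ∫ w, Real.exp (c * min (G w) (N : ℝ)) ∂Q ≤ Real.exp κ := by
    rw [integral_eq_lintegral_of_nonneg_ae (Eventually.of_forall fun w => (Real.exp_pos _).le)
      hintQ.aestronglyMeasurable, ← ENNReal.toReal_ofReal (Real.exp_pos κ).le]
    refine ENNReal.toReal_mono ENNReal.ofReal_ne_top ((lintegral_mono fun w => ?_).trans hexp)
    exact ENNReal.ofReal_le_ofReal
      (Real.exp_le_exp.2 (mul_le_mul_of_nonneg_left (min_le_left _ _) hc.le))
  exact (Real.log_le_iff_le_exp (integral_exp_pos hintQ)).2 hX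

/-! ### The stub -/

/-- **Entropy inequality for an unbounded nonnegative static functional along the flow.** For a
hard-sphere flow `Φ`, probability laws `P` (initial data) and `Q` (reference) with
`KL((Φ_r)_* P ‖ Q) < ∞`, a measurable `G ≥ 0` with `G ∘ Φ_r ∈ L¹(P)`, `c > 0` and
`∫⁻ e^{c G} dQ ≤ e^κ`: `∫ G (Φ_r z) dP(z) ≤ c⁻¹ · (KL((Φ_r)_* P ‖ Q) + κ)` (bounded case
`integral_comp_flow_le_klDiv_add_log` for the truncations `min G N`, then `N → ∞` by dominated
convergence). [cite: KipnisLandim1999, Appendix 1 Thm. 8.3] -/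
theorem integral_comp_flow_le_klDiv_add_log_of_nonneg : ∀ {ε : ℝ} {n : ℕ} (Φ : HardSphereFlow (Torus.geometry (Fin 3)) ε n) (P Q : Measure (Config n (Fin 3) T3)) [IsProbabilityMeasure P] [IsProbabilityMeasure Q] (r : ℝ), InformationTheory.klDiv (Φ.lawAt P r) Q ≠ ⊤ → ∀ {G : Config n (Fin 3) T3 → ℝ}, Measurable G → (∀ w, 0 ≤ G w) → Integrable (fun z => G (Φ.flow r z)) P → ∀ {c κ : ℝ}, 0 < c → ∫⁻ w, ENNReal.ofReal (Real.exp (c * G w)) ∂Q ≤ ENNReal.ofReal (Real.exp κ) → ∫ z, G (Φ.flow r z) ∂P ≤ c⁻¹ * ((InformationTheory.klDiv (Φ.lawAt P r) Q).toReal + κ) := by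
  intro ε n Φ P Q _ _ r hfin G hG hG0 hint c κ hc hexp
  -- the bound for every truncation level `N`
  have hN : ∀ N : ℕ, ∫ z, min (G (Φ.flow r z)) (N : ℝ) ∂P ≤
      c⁻¹ * ((InformationTheory.klDiv (Φ.lawAt P r) Q).toReal + κ) := by
    intro N
    have hGN : Measurable fun w => min (G w) (N : ℝ) := hG.min measurable_const
    have hbd : ∀ w, 0 ≤ min (G w) (N : ℝ) ∧ min (G w) (N : ℝ) ≤ N := fun w =>
      ⟨le_min (hG0 w) N.cast_nonneg, min_le_right _ _⟩
    calc ∫ z, min (G (Φ.flow r z)) (N : ℝ) ∂P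
        ≤ c⁻¹ * ((InformationTheory.klDiv (Φ.lawAt P r) Q).toReal +
            Real.log (∫ w, Real.exp (c * min (G w) (N : ℝ)) ∂Q)) :=
          integral_comp_flow_le_klDiv_add_log Φ P Q r hfin hGN hbd hc
      _ ≤ c⁻¹ * ((InformationTheory.klDiv (Φ.lawAt P r) Q).toReal + κ) :=
          mul_le_mul_of_nonneg_left
            (add_le_add le_rfl (wd_log_integral_exp_mul_min_le Q hG hc hexp N))
            (inv_nonneg.2 hc.le)
  -- dominated convergence of the truncations, dominator `G ∘ Φ_r`
  have hlim : Tendsto (fun N : ℕ => ∫ z, min (G (Φ.flow r z)) (N : ℝ) ∂P) atTop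
      (nhds (∫ z, G (Φ.flow r z) ∂P)) := by
    refine tendsto_integral_of_dominated_convergence (fun z => G (Φ.flow r z)) (fun N => ?_) hint
      (fun N => Eventually.of_forall fun z => ?_)
      (Eventually.of_forall fun z => wd_tendsto_min_natCast _)
    · exact ((hG.comp (Φ.measurable_flow r)).min measurable_const).aestronglyMeasurable
    · rw [Real.norm_eq_abs, abs_of_nonneg (le_min (hG0 _) N.cast_nonneg)]
      exact min_le_left _ _
  exact le_of_tendsto' hlim hN

end Summit.AtomisticToContinuum.HydrodynamicLimit.Theorems.NearConstantShortTimeHL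

end
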